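import Summits.CriticalPhenomena.SAWScalingLimit.Theorems.SAWTotalPositivityBoundaryTP2Defs
import Summits.CriticalPhenomena.SAWScalingLimit.Theorems.SAWTotalPositivityBoundaryTP2Kernel
import Summits.CriticalPhenomena.SAWScalingLimit.Theorems.SAWTotalPositivityBoundaryTP2Symmetry
import Summits.CriticalPhenomena.SAWScalingLimit.Theorems.SAWTotalPositivityBoundaryTP2RectReflect
import Summits.CriticalPhenomena.SAWScalingLimit.Theorems.SAWTotalPositivityBoundaryTP2LadderRung
import Summits.CriticalPhenomena.SAWScalingLimit.Theorems.SAWTotalPositivityBoundaryTP2LadderKernelsInterior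
import Summits.CriticalPhenomena.SAWScalingLimit.Theorems.EdgeOfPositivity.Negative.EdgeOfPositivityRectDomain
import HarnessLib

/-!
# Crux `BoundaryTP2` (stmt-CriticalPhenomena-7115), line `Sketch`: facing rung pairs on the ladders

Tool stub `stub_ladder_facingRungs` of the line's skeleton: on the ladder
`R_L = discreteDomainGraph (rectDomain L 1) 1` (sites `{0..L} × {0,1}`), for columns `c₁ < c₂ ≤ L`
and every fugacity `0 ≤ x ≤ 1/2`, the two crossing kernels between the end points of the rungs at
`c₁` and `c₂` weigh at most the two rungs:

  `Z((c₁,0),(c₂,1)) · Z((c₂,0),(c₁,1)) ≤ Z((c₁,0),(c₁,1)) · Z((c₂,0),(c₂,1))`,  `Z = pathKernel R_L x`.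

Proof. Write `E_k = Σ_{d<k} x^{2d+3}`, `m + 1 = c₂ - c₁`, `P = 1 + x`, `M = 1 - x`. The landed kernels
give `rung(c) = x + E_c + E_{L-c}` (`stub_ladderRung`) and, for BOTH crossing kernels
(`stub_ladderKernels_interior` with `r ≠ s`, after `pathKernel_comm` for the second one),

  `C = x^{m+1}/2 · [(P^{m+2} - M^{m+2}) + (E_{c₁} + E_{L-c₂})(P^{m+1} + M^{m+1}) + E_{c₁}E_{L-c₂}(P^m - M^m)]`

(`facing_kernel`). On `[0, 1/2]` the sequences `x^n (P^{n+1} - M^{n+1})` and `x^n (P^n + M^n)` are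
non-increasing in `n` (`facing_A_step`, `facing_B_step`: from the `tanh`-type bound
`x (P^n + M^n) ≤ P^n - M^n`, `n ≥ 1`, and `2x ≤ 1`, `x + x² ≤ 1`), whence
`x^{m+1}(P^{m+2} - M^{m+2}) ≤ 4x²`, `x^{m+1}(P^{m+1} + M^{m+1}) ≤ 2x`, `x^{m+1}(P^m - M^m) ≤ 2x³` and

  `C ≤ 2x² + x (E_{c₁} + E_{L-c₂}) + x³ E_{c₁} E_{L-c₂} ≤ x + E_{c₁} + E_{L-c₂}`

(`2x ≤ 1`, `E_{c₁} ≤ 1/6`; `facing_cross_le`). Since `E_k` is monotone in `k`, `x + E_{c₁} + E_{L-c₂}`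
is at most either rung, so `C · C ≤ rung(c₁) · rung(c₂)`. The assembly in `ℝ≥0∞` is
`ENNReal.ofReal_mul` / `ENNReal.ofReal_le_ofReal`.
-/

noncomputable section

namespace Summit.CriticalPhenomena.SAWScalingLimit.Theorems.BoundaryTP2

open Literature.Probability.LatticeModels Literature.Probability.RandomPlanarGeometry
open Summit.CriticalPhenomena.SAWScalingLimit.Theorems.EdgeOfPositivity.Negative
open scoped ENNReal

/-! ## The excursion sums `E_k = Σ_{d<k} x^{2d+3}` -/

/-- `E_k ≥ 0` for `x ≥ 0`. [folklore] -/
private theorem facing_E_nonneg {x : ℝ} (hx : 0 ≤ x) (k : ℕ) :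
    0 ≤ ∑ d ∈ Finset.range k, x ^ (2 * d + 3) :=
  Finset.sum_nonneg fun _ _ => pow_nonneg hx _

/-- Telescoping: `E_k (1 - x²) + x^{2k+3} = x³`. [folklore] -/
private theorem facing_E_telescope (x : ℝ) (k : ℕ) :
    (∑ d ∈ Finset.range k, x ^ (2 * d + 3)) * (1 - x ^ 2) + x ^ (2 * k + 3) = x ^ 3 := by
  -- adapted from …BoundaryTP2LadderBottomRowAdjacent (`ladderAdj_E_telescope`)
  induction k with
  | zero => simp
  | succ k ih =>
    rw [Finset.sum_range_succ]
    linear_combination ih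

/-- `E_k ≤ 1/6` for `0 ≤ x ≤ 1/2` (from `E_k (1 - x²) ≤ x³ ≤ 1/8` and `1 - x² ≥ 3/4`).
[folklore] -/
private theorem facing_E_le {x : ℝ} (hx0 : 0 ≤ x) (hx : x ≤ 1 / 2) (k : ℕ) :
    ∑ d ∈ Finset.range k, x ^ (2 * d + 3) ≤ 1 / 6 := by
  -- adapted from …BoundaryTP2LadderBottomRowAdjacent (`ladderAdj_E_le`)
  have h := facing_E_telescope x k
  have hE := facing_E_nonneg hx0 k
  have hk : 0 ≤ x ^ (2 * k + 3) := pow_nonneg hx0 _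
  have hx2 : x ^ 2 ≤ (1 / 2) ^ 2 := pow_le_pow_left₀ hx0 hx 2
  have hx3 : x ^ 3 ≤ (1 / 2) ^ 3 := pow_le_pow_left₀ hx0 hx 3
  norm_num at hx2 hx3
  nlinarith [mul_nonneg hE (by linarith : (0 : ℝ) ≤ 1 / 4 - x ^ 2)]

/-- `E_k` is monotone in `k` for `x ≥ 0`. [folklore] -/
private theorem facing_E_mono {x : ℝ} (hx : 0 ≤ x) {k l : ℕ} (hkl : k ≤ l) :
    ∑ d ∈ Finset.range k, x ^ (2 * d + 3) ≤ ∑ d ∈ Finset.range l, x ^ (2 * d + 3) :=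
  Finset.sum_le_sum_of_subset_of_nonneg (Finset.range_mono hkl) fun _ _ _ => pow_nonneg hx _

/-! ## The zigzag factors `P^n ± M^n`, `P = 1 + x`, `M = 1 - x` -/

/-- `P^n - M^n ≥ 0` for `0 ≤ x ≤ 1`. [folklore] -/
private theorem facing_D_nonneg {x : ℝ} (n : ℕ) (hx0 : 0 ≤ x) (hx1 : x ≤ 1) :
    0 ≤ (1 + x) ^ n - (1 - x) ^ n :=
  sub_nonneg.2 (pow_le_pow_left₀ (by linarith) (by linarith) n)

/-- `tanh`-type bound: `x (P^{k+1} + M^{k+1}) ≤ P^{k+1} - M^{k+1}` for `0 ≤ x ≤ 1` (the difference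
is `(1-x)(1+x)(P^k - M^k) ≥ 0`). [folklore] -/
private theorem facing_tanh {x : ℝ} (k : ℕ) (hx0 : 0 ≤ x) (hx1 : x ≤ 1) :
    x * ((1 + x) ^ (k + 1) + (1 - x) ^ (k + 1)) ≤ (1 + x) ^ (k + 1) - (1 - x) ^ (k + 1) := by
  have h0 : 0 ≤ (1 - x) * (1 + x) * ((1 + x) ^ k - (1 - x) ^ k) :=
    mul_nonneg (mul_nonneg (by linarith) (by linarith)) (facing_D_nonneg k hx0 hx1)
  have key : (1 + x) ^ (k + 1) - (1 - x) ^ (k + 1) - x * ((1 + x) ^ (k + 1) + (1 - x) ^ (k + 1)) =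
      (1 - x) * (1 + x) * ((1 + x) ^ k - (1 - x) ^ k) := by ring
  linarith [key, h0]

/-- One step of the first monotone sequence: `x^{n+1} (P^{n+2} - M^{n+2}) ≤ x^n (P^{n+1} - M^{n+1})`
on `[0, 1/2]` (`P^{n+2} - M^{n+2} = (P^{n+1} - M^{n+1}) + x (P^{n+1} + M^{n+1})`, `facing_tanh`,
`2x ≤ 1`). [folklore] -/
private theorem facing_A_step {x : ℝ} (n : ℕ) (hx0 : 0 ≤ x) (hx : x ≤ 1 / 2) :
    x ^ (n + 1) * ((1 + x) ^ (n + 2) - (1 - x) ^ (n + 2)) ≤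
      x ^ n * ((1 + x) ^ (n + 1) - (1 - x) ^ (n + 1)) := by
  have hD := facing_D_nonneg (n + 1) hx0 (by linarith)
  have ht := facing_tanh n hx0 (by linarith)
  have h1 : x * ((1 + x) ^ (n + 2) - (1 - x) ^ (n + 2)) ≤ (1 + x) ^ (n + 1) - (1 - x) ^ (n + 1) := by
    have e : (1 + x) ^ (n + 2) - (1 - x) ^ (n + 2) =
        ((1 + x) ^ (n + 1) - (1 - x) ^ (n + 1)) + x * ((1 + x) ^ (n + 1) + (1 - x) ^ (n + 1)) := by
      ring
    rw [e]
    nlinarith [mul_le_mul_of_nonneg_left ht hx0, mul_nonneg (by linarith : (0 : ℝ) ≤ 1 - 2 * x) hD]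
  calc x ^ (n + 1) * ((1 + x) ^ (n + 2) - (1 - x) ^ (n + 2))
      = x ^ n * (x * ((1 + x) ^ (n + 2) - (1 - x) ^ (n + 2))) := by ring
    _ ≤ x ^ n * ((1 + x) ^ (n + 1) - (1 - x) ^ (n + 1)) :=
        mul_le_mul_of_nonneg_left h1 (pow_nonneg hx0 n)

/-- First monotone sequence from `n = 0`: `x^n (P^{n+1} - M^{n+1}) ≤ 2x` on `[0, 1/2]`. [folklore] -/
private theorem facing_A_le₀ {x : ℝ} (n : ℕ) (hx0 : 0 ≤ x) (hx : x ≤ 1 / 2) :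
    x ^ n * ((1 + x) ^ (n + 1) - (1 - x) ^ (n + 1)) ≤ 2 * x := by
  induction n with
  | zero => apply le_of_eq; ring
  | succ n ih => exact (facing_A_step n hx0 hx).trans ih

/-- First monotone sequence from `n = 1`: `x^{n+1} (P^{n+2} - M^{n+2}) ≤ 4x²` on `[0, 1/2]`.
[folklore] -/
private theorem facing_A_le₁ {x : ℝ} (n : ℕ) (hx0 : 0 ≤ x) (hx : x ≤ 1 / 2) :
    x ^ (n + 1) * ((1 + x) ^ (n + 2) - (1 - x) ^ (n + 2)) ≤ 4 * x ^ 2 := by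
  induction n with
  | zero => apply le_of_eq; ring
  | succ n ih => exact (facing_A_step (n + 1) hx0 hx).trans ih

/-- One step of the second monotone sequence: `x^{n+1} (P^{n+1} + M^{n+1}) ≤ x^n (P^n + M^n)` on
`[0, 1/2]` (`P^{n+1} + M^{n+1} = (P^n + M^n) + x (P^n - M^n)` and `x + x² ≤ 1`). [folklore] -/
private theorem facing_B_step {x : ℝ} (n : ℕ) (hx0 : 0 ≤ x) (hx : x ≤ 1 / 2) :
    x ^ (n + 1) * ((1 + x) ^ (n + 1) + (1 - x) ^ (n + 1)) ≤ x ^ n * ((1 + x) ^ n + (1 - x) ^ n) := by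
  have hM : 0 ≤ (1 - x) ^ n := pow_nonneg (by linarith) n
  have hP : 0 ≤ (1 + x) ^ n := pow_nonneg (by linarith) n
  have h1 : x * ((1 + x) ^ (n + 1) + (1 - x) ^ (n + 1)) ≤ (1 + x) ^ n + (1 - x) ^ n := by
    have e : (1 + x) ^ (n + 1) + (1 - x) ^ (n + 1) =
        ((1 + x) ^ n + (1 - x) ^ n) + x * ((1 + x) ^ n - (1 - x) ^ n) := by ring
    rw [e]
    nlinarith [mul_le_mul_of_nonneg_right hx hP, mul_le_mul_of_nonneg_right hx hM,
      mul_le_mul_of_nonneg_right hx (mul_nonneg hx0 hP), mul_nonneg hx0 (mul_nonneg hx0 hM)]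
  calc x ^ (n + 1) * ((1 + x) ^ (n + 1) + (1 - x) ^ (n + 1))
      = x ^ n * (x * ((1 + x) ^ (n + 1) + (1 - x) ^ (n + 1))) := by ring
    _ ≤ x ^ n * ((1 + x) ^ n + (1 - x) ^ n) := mul_le_mul_of_nonneg_left h1 (pow_nonneg hx0 n)

/-- Second monotone sequence from `n = 1`: `x^{n+1} (P^{n+1} + M^{n+1}) ≤ 2x` on `[0, 1/2]`.
[folklore] -/
private theorem facing_B_le {x : ℝ} (n : ℕ) (hx0 : 0 ≤ x) (hx : x ≤ 1 / 2) :
    x ^ (n + 1) * ((1 + x) ^ (n + 1) + (1 - x) ^ (n + 1)) ≤ 2 * x := by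
  induction n with
  | zero => apply le_of_eq; ring
  | succ n ih => exact (facing_B_step (n + 1) hx0 hx).trans ih

/-- The third factor: `x^{m+1} (P^m - M^m) ≤ 2x³` on `[0, 1/2]` (zero for `m = 0`, else `x²` times
the first sequence). [folklore] -/
private theorem facing_G_le {x : ℝ} (m : ℕ) (hx0 : 0 ≤ x) (hx : x ≤ 1 / 2) :
    x ^ (m + 1) * ((1 + x) ^ m - (1 - x) ^ m) ≤ 2 * x ^ 3 := by
  cases m with
  | zero => simp only [pow_zero, sub_self, mul_zero]; positivity
  | succ k =>
    calc x ^ (k + 1 + 1) * ((1 + x) ^ (k + 1) - (1 - x) ^ (k + 1))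
        = x ^ 2 * (x ^ k * ((1 + x) ^ (k + 1) - (1 - x) ^ (k + 1))) := by ring
      _ ≤ x ^ 2 * (2 * x) := mul_le_mul_of_nonneg_left (facing_A_le₀ k hx0 hx) (pow_nonneg hx0 2)
      _ = 2 * x ^ 3 := by ring

/-! ## The crossing kernel's real form -/

/-- The real form of a crossing kernel is nonnegative (`0 ≤ x ≤ 1`, `e, f ≥ 0`). [folklore] -/
private theorem facing_cross_nonneg {x e f : ℝ} (m : ℕ) (hx0 : 0 ≤ x) (hx1 : x ≤ 1) (he : 0 ≤ e)
    (hf : 0 ≤ f) :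
    0 ≤ x ^ (m + 1) / 2 * (((1 + x) ^ (m + 2) - (1 - x) ^ (m + 2)) +
      (e + f) * ((1 + x) ^ (m + 1) + (1 - x) ^ (m + 1)) + e * f * ((1 + x) ^ m - (1 - x) ^ m)) := by
  have h3 : 0 ≤ (1 + x) ^ (m + 1) + (1 - x) ^ (m + 1) :=
    add_nonneg (pow_nonneg (by linarith) _) (pow_nonneg (by linarith) _)
  exact mul_nonneg (by positivity) (add_nonneg (add_nonneg (facing_D_nonneg (m + 2) hx0 hx1)
    (mul_nonneg (add_nonneg he hf) h3)) (mul_nonneg (mul_nonneg he hf) (facing_D_nonneg m hx0 hx1)))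

/-- **Key bound.** The crossing kernel's real form is at most `x + e + f` for `0 ≤ x ≤ 1/2`,
`0 ≤ e ≤ 1/6`, `0 ≤ f`: `C ≤ 2x² + x (e + f) + x³ e f ≤ x + e + f`. [folklore] -/
private theorem facing_cross_le {x e f : ℝ} (m : ℕ) (hx0 : 0 ≤ x) (hx : x ≤ 1 / 2) (he : 0 ≤ e)
    (he' : e ≤ 1 / 6) (hf : 0 ≤ f) :
    x ^ (m + 1) / 2 * (((1 + x) ^ (m + 2) - (1 - x) ^ (m + 2)) +
      (e + f) * ((1 + x) ^ (m + 1) + (1 - x) ^ (m + 1)) + e * f * ((1 + x) ^ m - (1 - x) ^ m)) ≤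
      x + e + f := by
  have hA := facing_A_le₁ m hx0 hx
  have hB := facing_B_le m hx0 hx
  have hG := facing_G_le m hx0 hx
  have hx3 : x ^ 3 ≤ (1 / 2) ^ 3 := pow_le_pow_left₀ hx0 hx 3
  norm_num at hx3
  have hef : 0 ≤ e * f := mul_nonneg he hf
  have e1 : x ^ (m + 1) / 2 * (((1 + x) ^ (m + 2) - (1 - x) ^ (m + 2)) +
      (e + f) * ((1 + x) ^ (m + 1) + (1 - x) ^ (m + 1)) + e * f * ((1 + x) ^ m - (1 - x) ^ m)) =
      (x ^ (m + 1) * ((1 + x) ^ (m + 2) - (1 - x) ^ (m + 2)) +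
        (e + f) * (x ^ (m + 1) * ((1 + x) ^ (m + 1) + (1 - x) ^ (m + 1))) +
        e * f * (x ^ (m + 1) * ((1 + x) ^ m - (1 - x) ^ m))) / 2 := by ring
  rw [e1]
  have t2 : (e + f) * (x ^ (m + 1) * ((1 + x) ^ (m + 1) + (1 - x) ^ (m + 1))) ≤ (e + f) * (2 * x) :=
    mul_le_mul_of_nonneg_left hB (add_nonneg he hf)
  have t3 : e * f * (x ^ (m + 1) * ((1 + x) ^ m - (1 - x) ^ m)) ≤ e * f * (2 * x ^ 3) :=
    mul_le_mul_of_nonneg_left hG hef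
  have u1 : 4 * x ^ 2 ≤ 2 * x := by nlinarith [mul_nonneg hx0 (by linarith : (0 : ℝ) ≤ 1 - 2 * x)]
  have u2 : (e + f) * (2 * x) ≤ (e + f) * 1 := mul_le_mul_of_nonneg_left (by linarith) (add_nonneg he hf)
  have u3 : e * f * (2 * x ^ 3) ≤ e * f * (1 / 4) := mul_le_mul_of_nonneg_left (by linarith) hef
  have u4 : e * f ≤ 1 / 6 * f := mul_le_mul_of_nonneg_right he' hf
  linarith

/-- The real inequality behind the stub: with `C` the crossing kernel's real form
(`e₁ = E_{c₁}`, `f₂ = E_{L-c₂}`), `C · C ≤ (x + e₁ + f₁)(x + e₂ + f₂)` whenever `e₁ ≤ e₂` and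
`f₂ ≤ f₁` (both factors via `C ≤ x + e₁ + f₂`). [folklore] -/
private theorem facing_real {x e₁ e₂ f₁ f₂ : ℝ} (m : ℕ) (hx0 : 0 ≤ x) (hx : x ≤ 1 / 2) (he₁ : 0 ≤ e₁)
    (he₁' : e₁ ≤ 1 / 6) (hf₂ : 0 ≤ f₂) (h₁₂ : e₁ ≤ e₂) (h₂₁ : f₂ ≤ f₁) :
    x ^ (m + 1) / 2 * (((1 + x) ^ (m + 2) - (1 - x) ^ (m + 2)) +
          (e₁ + f₂) * ((1 + x) ^ (m + 1) + (1 - x) ^ (m + 1)) + e₁ * f₂ * ((1 + x) ^ m - (1 - x) ^ m)) *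
        (x ^ (m + 1) / 2 * (((1 + x) ^ (m + 2) - (1 - x) ^ (m + 2)) +
          (e₁ + f₂) * ((1 + x) ^ (m + 1) + (1 - x) ^ (m + 1)) +
          e₁ * f₂ * ((1 + x) ^ m - (1 - x) ^ m))) ≤
      (x + e₁ + f₁) * (x + e₂ + f₂) := by
  have hC0 := facing_cross_nonneg m hx0 (by linarith) he₁ hf₂
  have hC := facing_cross_le m hx0 hx he₁ he₁' hf₂
  exact mul_le_mul (hC.trans (by linarith)) (hC.trans (by linarith)) hC0 (by linarith)

/-! ## The crossing kernels of the ladder -/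

/-- The crossing kernels of the ladder `{0..L}×{0,1}` in closed form: for `i + m + 1 = j ≤ L`, `x ≥ 0`
and `r ≠ s` in `{0,1}`,
`Z_{R_L}((i,r),(j,s)) = x^{m+1}/2 · [(P^{m+2} - M^{m+2}) + (E_i + E_{L-j})(P^{m+1} + M^{m+1})
  + E_i E_{L-j} (P^m - M^m)]`, `P = 1+x`, `M = 1-x` (`stub_ladderKernels_interior` with `ε = -1`).
[folklore] -/
private theorem facing_kernel (L i j m : ℕ) (hm : i + m + 1 = j) (hjL : j ≤ L) {x : ℝ} (hx : 0 ≤ x)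
    (r s : ℤ) (hr : r = 0 ∨ r = 1) (hs : s = 0 ∨ s = 1) (hrs : r ≠ s) :
    pathKernel (discreteDomainGraph (rectDomain L 1) 1) x (st i r) (st j s) =
      ENNReal.ofReal (x ^ (m + 1) / 2 *
        (((1 + x) ^ (m + 2) - (1 - x) ^ (m + 2)) +
          ((∑ d ∈ Finset.range i, x ^ (2 * d + 3)) + ∑ d ∈ Finset.range (L - j), x ^ (2 * d + 3)) *
            ((1 + x) ^ (m + 1) + (1 - x) ^ (m + 1)) +
          (∑ d ∈ Finset.range i, x ^ (2 * d + 3)) * (∑ d ∈ Finset.range (L - j), x ^ (2 * d + 3)) *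
            ((1 + x) ^ m - (1 - x) ^ m))) := by
  rw [stub_ladderKernels_interior L i j (by omega) hjL hx r s hr hs, if_neg hrs]
  congr 1
  subst hm
  have e1 : i + m + 1 - i = m + 1 := by omega
  have e2 : m + 1 - 1 = m := rfl
  rw [e1, e2]
  ring

/-! ## The stub -/

/-- **Tool stub `stub_ladder_facingRungs`.** On the ladder `{0..L}×{0,1}`, for columns `c₁ < c₂ ≤ L`
and `0 ≤ x ≤ 1/2`: the two crossing kernels between the rung pairs weigh at most the two rungs,
`Z((c₁,0),(c₂,1)) · Z((c₂,0),(c₁,1)) ≤ Z((c₁,0),(c₁,1)) · Z((c₂,0),(c₂,1))`. Mechanism: both crossing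
kernels equal `C ≤ x + E_{c₁} + E_{L-c₂}` (`facing_cross_le`: the zigzag factors `x^n(P^{n+1} - M^{n+1})`,
`x^n(P^n + M^n)` are non-increasing in `n` on `[0, 1/2]`), which is at most either rung
`x + E_c + E_{L-c}` since `E_k` is monotone in `k`. [folklore] -/
theorem stub_ladder_facingRungs (L : ℕ) {c₁ c₂ : ℕ} (h₁₂ : c₁ < c₂) (h₂ : c₂ ≤ L) {x : ℝ} (hx0 : 0 ≤ x)
    (hx : x ≤ 1 / 2) :
    pathKernel (discreteDomainGraph (rectDomain L 1) 1) x (st c₁ 0) (st c₂ 1) *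
        pathKernel (discreteDomainGraph (rectDomain L 1) 1) x (st c₂ 0) (st c₁ 1) ≤
      pathKernel (discreteDomainGraph (rectDomain L 1) 1) x (st c₁ 0) (st c₁ 1) *
        pathKernel (discreteDomainGraph (rectDomain L 1) 1) x (st c₂ 0) (st c₂ 1) := by
  obtain ⟨m, hm⟩ : ∃ m, c₁ + m + 1 = c₂ := ⟨c₂ - c₁ - 1, by omega⟩
  have hE := fun k => facing_E_nonneg hx0 k
  have hE' := fun k => facing_E_le hx0 hx k
  rw [pathKernel_comm _ x (st c₂ 0) (st c₁ 1),
    facing_kernel L c₁ c₂ m hm h₂ hx0 0 1 (Or.inl rfl) (Or.inr rfl) (by norm_num),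
    facing_kernel L c₁ c₂ m hm h₂ hx0 1 0 (Or.inr rfl) (Or.inl rfl) (by norm_num),
    stub_ladderRung L c₁ (by omega) hx0, stub_ladderRung L c₂ h₂ hx0,
    ← ENNReal.ofReal_mul (facing_cross_nonneg m hx0 (by linarith) (hE c₁) (hE (L - c₂))),
    ← ENNReal.ofReal_mul (add_nonneg (add_nonneg hx0 (hE c₁)) (hE (L - c₁)))]
  exact ENNReal.ofReal_le_ofReal (facing_real m hx0 hx (hE c₁) (hE' c₁) (hE (L - c₂))
    (facing_E_mono hx0 (by omega : c₁ ≤ c₂)) (facing_E_mono hx0 (by omega : L - c₂ ≤ L - c₁)))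

end Summit.CriticalPhenomena.SAWScalingLimit.Theorems.BoundaryTP2
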